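import Literature.MathematicalPhysics.QuantumFieldTheory.Balaban1983to89.B4CubeFieldHyps22
import Literature.MathematicalPhysics.QuantumFieldTheory.Balaban1983to89.B4Eq220FactorField
import Literature.MathematicalPhysics.QuantumFieldTheory.Balaban1983to89.B4Eq218FirstFactor

/-!
# [B4] (2.20)/(2.21) AND THE FIRST FACTOR OF (2.13) AT THE INTERIOR CUBES FOR A (1.7)-REGULAR FIELD: the per-cube
# inputs «‖K_jG_k(□_j,Ã_j)h_j‖ ≤ c₂O(1)M⁻¹», «c₁» of the walk expansion AT THE CUBE CONFIGURATION `Ã_j = A₀ + θ_jA′`,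
# with only «e sufficiently small» [Balaban1983RegularityDecay]

statement-level skeleton of published theorems with citation tags; proofs where landed; nothing here is a claim about the Yang–Mills mass gap

CITATION HEADER.  T. Bałaban, *Regularity and decay of lattice Green's functions*, Commun. Math. Phys. **89** (1983)
571–597, doi:10.1007/bf01214744 [Balaban1983RegularityDecay] (cell paper B4; held text
`paper:balaban1983-cmp89-regularity-decay`, journal page = PDF page + 570; pp. 573, 575, 577–579).  PDF held: yes.
Unit `lit-balaban-p35` gen 6 (Phase-2 proof seat), HOME `run/shared/lean/pub/lit-balaban/`.  WHAT IS REPRODUCED: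
SKELETON rows **B4.Eq2.18** ((2.18)–(2.22): the per-cube factors of (2.20)/(2.21) and the first factor `c₁`, at the
interior cubes), **B4.Eq2.2** / **B4.Def§2** (the `Ã_j` of (2.2)), **B4.Thm@573** (the per-cube sup input `β` of the
walk route `B4Ineq110WalkRoute` at the interior cubes, reduced to the printed regularity (1.7)), **B4.Lem2.2** ((2.17) sup members at `Ã_j`: the input `γ`).  File 3 of 3 (file 1
`B4CubeFields22`: construction of `Ã_j` and the sizes from (1.7); file 2 `B4CubeFieldHyps22`: the field hypotheses of
the Lemma-2.2 lineage at `Ã_j`, charge scaling, the threshold).  Imports `B4CubeFieldHyps22` and p35 gen 5's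
`B4Eq220FactorField` (`eq220_hBox_sup_stair`, `eq221_hBox_weighted_stair`) / `B4Eq218FirstFactor`
(`eq218_first_hBox_sup_stair`) — the factor bounds at `Ã = A₀ + A′` under explicit hypotheses on `A′`, here DISCHARGED.

WHAT IS PRINTED (p. 578, verbatim).  «We estimate the first sum using Lemma 2.2 by
(2.20) Σ′_{ω:n≤n₀}c₁‖K_{ω₁}G_k(□_{ω₁},Ã_{ω₁})h_{ω₁}‖_∞ · … · ‖K_{ω_n}G_k(□_{ω_n},Ã_{ω_n})h_{ω_n}‖_∞‖f‖_∞
≤ Σ′_{ω:n≤n₀}c₁(c₂O(1)M⁻¹)ⁿ‖f‖_∞. … We estimate the second sum by (2.21) Σ′_{ω:n>n₀}c₁‖K_{ω₁}G_k(□_{ω₁},Ã_{ω₁})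
h_{ω₁}‖_{∞,p₁}Π_{i=2}^{n₀}‖K_{ω_i}G_k(□_{ω_i},Ã_{ω_i})h_{ω_i}‖_{p₁/(i−1),p₁/i} Π_{i=n₀+1}^{n}‖K_{ω_i}G_k(□_{ω_i},Ã_{ω_i})
h_{ω_i}‖_{2,2}‖f‖₂ ≤ Σ′_{ω:n>n₀}c₁(c₂O(1)M⁻¹)ⁿ‖f‖_∞.»; p. 575: «if □_j is an interior cube of Ω, then … Ã_j = A₀ +
θ_jA′»; p. 573: «for e sufficiently small», (1.7) «|(∂^η_μA)(x)| ≤ ce^{β−1}».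

WHAT THIS MODULE PROVES (all in full; `d + 1` lattice dimensions; box `□ = Π_μ[0, nM_μ)`, `n = L^k`, `L = ℓ + 1 ≥ 2`,
`M_μ ≤ S`, `K ∣ M_μ`, the cube of the label `j` inside (`K(j_μ + 1) ≤ M_μ`, `j_μ ≥ 1`), `nK ≥ 16`; `A` in component
form, (1.7)-regular on `□` with constants `c, β > 0`; [B4]'s own `h_j` (`B4Eq220PartitionSizes.hBox`); coupling `e/n`).
QUANTIFIER ORDER (the print's): the constant `C` first (Lemma 2.2 at charge `1`: `d`, `N`, flow, `L`, the windows
`[a₋,a₊]`, `[0,m²₊]`[, `p₁`]), then for the regularity constants `(c, β)`, the side bound `S` and the cube size `K` a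
threshold `e₁`, then the instance (mesh, `a`, `m²`, box, label, field, charge `0 < e ≤ e₁`).
* **`eq220_cubeField`** — (2.20): `‖K_{h_j}G_k(□,Ã_j)(h_jΦ)‖_∞ ≤ (C/K)‖Φ‖_∞`.
* **`eq221_cubeField`** — (2.21): every `η`-weighted factor, all pairs `1 ≤ p ≤ q < ∞` with `1/p − 1/q ≤ 1/p₁`,
  `p₁ > d + 1`: `‖K_{h_j}G_k(□,Ã_j)(h_jΦ)‖_{q,η} ≤ (C/K)‖Φ‖_{p,η}`.
* **`eq218_cubeField`** — the first factor and its covariant derivative: `‖h_jG_k(□,Ã_j)(h_jΦ)‖_∞ ≤ C‖Φ‖_∞`,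
  `‖D^η_{Ã_j,μ}h_jG_k(□,Ã_j)(h_jΦ)‖_∞ ≤ C‖Φ‖_∞`.
* **`lemma22_sup_cubeField`** — LEMMA 2.2 (2.17) sup members at `Ã_j` (the per-cube input `γ` and the covariant
  derivative): `‖G_k(□,Ã_j)Φ‖_∞ ≤ C‖Φ‖_∞`, `‖D^η_{Ã_j,μ}G_k(□,Ã_j)Φ‖_∞ ≤ C‖Φ‖_∞` (row **B4.Lem2.2** at the cube
  configuration of a (1.7)-regular field; `B4Lemma22SupStair.lemma22_17_sup_stair` discharged).
* (v1.1, append-only) **`lemma22_weighted_cubeField`** — LEMMA 2.2 (2.17) in the printed `η`-weighted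
  `L^p → L^q` norms at `Ã_j`, members `G`, `D^η_{Ã_j,μ}G`, all pairs `1 ≤ p ≤ q < ∞` with `1/p − 1/q ≤ 1/p₁`
  (`B4Lemma22EtaBox.lemma22_17_weighted_stair` discharged).
* **`eq220_cubeField_std`** — (2.20) on the print's cube itself: side `2K` (`M_μ = 2K`), label at the centre
  (`j_μ = 1`), every (1.7)-regular `A` on it, `0 < e ≤ e₁(c, β, K)`: the hypotheses of `eq220_cubeField` are met.
Mechanism: the lineage's theorems at charge `1` applied to the field `(e/n)Ã_j = (e/n)A₀ + A′`
(`B4CubeFieldHyps22.kOp_smul/greenA_smul/derivA_smul/smul_cubeField`), their field hypotheses supplied by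
`cubeField_hyps`, their smallness conditions by `cubeField_threshold`.

HONEST SCOPE.  (i) Interior cubes only (boundary cubes: `Ã_j = A`, Lemma 2.1 — `B4Eq221L2FactorRegion`,
`B4Eq221HjRegion`).  (ii) Box carriers of the Lemma-2.2 lineage with staircase contours; the identification with a
block of the region's Neumann-cut cube operator of `B4Eq213ConcreteWalk` (the hypothesis `hβ` of
`B4Ineq110WalkRoute.ineq110_value`) is NOT made here.  (iii) `C` depends on `(d, N, flow Lipschitz constant, L,
a₋, a₊, m²₊[, p₁])`, `e₁` in addition on `(c, β, S, K)` («c′ = dMc»); the field hypotheses are the lineage's reading of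
«A′ regular and small» realised by the construction of p. 575, nothing weaker.  Theorems only; no `def`, no `Prop`
fact, no `sorry`; axioms standard.
-/

namespace Literature.MathematicalPhysics.QuantumFieldTheory.Balaban1983to89.B4Eq220CubeField

open Finset Matrix
open Literature.MathematicalPhysics.QuantumFieldTheory.Balaban1983to89.B4GaugeCovariance
open Literature.MathematicalPhysics.QuantumFieldTheory.Balaban1983to89.B4Commutators25to211 (mulH)
open Literature.MathematicalPhysics.QuantumFieldTheory.Balaban1983to89.B4Reflection242 (boxDom nbrs)
open Literature.MathematicalPhysics.QuantumFieldTheory.Balaban1983to89.B4Lower18Regular (e1 baseEmb stairContour)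
open Literature.MathematicalPhysics.QuantumFieldTheory.Balaban1983to89.B4Lemma22Reduce231 (supN supN_nonneg)
open Literature.MathematicalPhysics.QuantumFieldTheory.Balaban1983to89.B4Lemma22ReduceZero (Box opA greenA derivA)
open Literature.MathematicalPhysics.QuantumFieldTheory.Balaban1983to89.B4Lemma22EtaBox (lpW lpW_nonneg
  lemma22_17_weighted_stair)
open Literature.MathematicalPhysics.QuantumFieldTheory.Balaban1983to89.B4PartitionUnity22 (hprof thetaProf D1 D2
  D1_nonneg D2_nonneg contDiff_hprof hasCompactSupport_hprof contDiff_thetaProf hasCompactSupport_thetaProf)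
open Literature.MathematicalPhysics.QuantumFieldTheory.Balaban1983to89.B4Eq220PartitionSizes (hBox)
open Literature.MathematicalPhysics.QuantumFieldTheory.Balaban1983to89.B4Eq220CommutatorField (kOp)
open Literature.MathematicalPhysics.QuantumFieldTheory.Balaban1983to89.B4Eq220FactorField (eq220_hBox_sup_stair
  eq221_hBox_weighted_stair)
open Literature.MathematicalPhysics.QuantumFieldTheory.Balaban1983to89.B4Eq218FirstFactor (eq218_first_hBox_sup_stair)
open Literature.MathematicalPhysics.QuantumFieldTheory.Balaban1983to89.B4Lemma22SupStair (lemma22_17_sup_stair)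
open Literature.MathematicalPhysics.QuantumFieldTheory.Balaban1983to89.B4CubeFields22
open Literature.MathematicalPhysics.QuantumFieldTheory.Balaban1983to89.B4CubeFieldHyps22

noncomputable section

variable {d : ℕ}

/-! ## §6. The pay-off: the per-cube factors (2.20)/(2.21) and the first factor at `Ã_j` for a (1.7)-regular field -/

section Payoff

variable {ι : Type} [Fintype ι] [DecidableEq ι]

/-- **(2.20) AT THE INTERIOR CUBES FOR A (1.7)-REGULAR FIELD — «‖K_jG_k(□_j,Ã_j)h_j‖_∞ ≤ c₂O(1)M⁻¹» WITH ONLY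
«e SUFFICIENTLY SMALL»**: there is `C > 0` (from Lemma 2.2 at charge `1`: `d`, `N`, the flow, `L`, the windows) such
that for every regularity pair `(c, β)`, `β > 0`, every side bound `S` and large-cube size `K ≥ 2` there is `e₁ > 0`
with: for every mesh `n = L^k` (`nK ≥ 16`), every `a, m²` of the windows, every box `□ = Π_μ[0, nM_μ)`
(`M_μ ≤ S`, `K ∣ M_μ`), every label `j` whose cube sits in `□` (`j_μ ≥ 1`, `K(j_μ + 1) ≤ M_μ`), EVERY vector field
`A` regular on `□` in the sense (1.7) and every charge `0 < e ≤ e₁`,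
`‖K_{h_j}G_k(□,Ã_j)(h_jΦ)‖_∞ ≤ (C/K)‖Φ‖_∞` at coupling `e/n` — the per-cube input `β` of the walk route
(`B4Ineq110WalkRoute`) at the interior cubes, reduced to (1.7).
[cite: Balaban1983RegularityDecay, (2.20) p. 578 «c₂O(1)M⁻¹» with §2 p. 575 (Ã_j) and (1.7) p. 573] -/
theorem eq220_cubeField (F : OrthFlow ι) {ℓ₁ : ℝ} (hℓ₁ : 0 ≤ ℓ₁)
    (hLip : ∀ t (v : ι → ℝ), ((F.U t - 1) *ᵥ v) ⬝ᵥ ((F.U t - 1) *ᵥ v) ≤ (ℓ₁ * t) ^ 2 * (v ⬝ᵥ v))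
    (d ℓ : ℕ) (hℓ : 1 ≤ ℓ) (amin aplus m2plus : ℝ) (ha : 0 < amin) :
    ∃ C : ℝ, 0 < C ∧ ∀ (creg β : ℝ), 0 ≤ creg → 0 < β → ∀ (S K : ℕ), 2 ≤ K →
      ∃ e₁ : ℝ, 0 < e₁ ∧ ∀ (k : ℕ), 1 ≤ k → ∀ (hn : 1 ≤ (ℓ + 1) ^ k), 16 ≤ (ℓ + 1) ^ k * K →
      ∀ (a m2 : ℝ), amin ≤ a → a ≤ aplus → 0 ≤ m2 → m2 ≤ m2plus →
      ∀ (M : Fin (d + 1) → ℕ), (∀ i, 1 ≤ M i) → (∀ i, M i ≤ S) → (∀ μ, K ∣ M μ) →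
      ∀ (j : Fin (d + 1) → ℤ), (∀ μ, 1 ≤ j μ) → (∀ μ, (K : ℤ) * (j μ + 1) ≤ M μ) →
      ∀ (Ac : (Fin (d + 1) → ℤ) → Fin (d + 1) → ℝ) (e : ℝ), 0 < e → e ≤ e₁ →
        (∀ x ∈ Box d ℓ k M, ∀ μ ν : Fin (d + 1),
          |Ac (x + e1 μ) ν - Ac x ν| ≤ creg * e ^ (β - 1) / ((ℓ + 1) ^ k : ℕ)) →
      ∀ Φ : ↥(Box d ℓ k M) × ι → ℝ,
        supN (kOp F (e / ((ℓ + 1) ^ k : ℕ)) ((ℓ + 1) ^ k) (B1.aSeq a ((ℓ : ℝ) + 1) k) m2 M (baseEmb hn M)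
              (stairContour hn M) (cubeField (Box d ℓ k M) ((ℓ + 1) ^ k) K j (Ac 0) Ac) (hBox ((ℓ + 1) ^ k) K M j)
            *ᵥ (greenA d F (e / ((ℓ + 1) ^ k : ℕ)) ℓ k a m2 M (baseEmb hn M) (stairContour hn M)
                (cubeField (Box d ℓ k M) ((ℓ + 1) ^ k) K j (Ac 0) Ac)
                *ᵥ (mulH (ι := ι) (hBox ((ℓ + 1) ^ k) K M j) *ᵥ Φ)))
          ≤ C / K * supN Φ := by
  obtain ⟨c, hc, hL⟩ := eq220_hBox_sup_stair F hℓ₁ hLip 1 d ℓ hℓ amin aplus m2plus ha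
  have hs : 0 ≤ ((d : ℝ) + 1) * (D1 hprof + D2 hprof) := by
    have := D1_nonneg contDiff_hprof hasCompactSupport_hprof
    have := D2_nonneg contDiff_hprof hasCompactSupport_hprof
    positivity
  by_cases hapl : aplus < amin
  · -- empty `a`-window: the statement is vacuous
    refine ⟨1, one_pos, fun creg β _ _ S K _ => ⟨1, one_pos, ?_⟩⟩
    intro k hk hn hnK a m2 e1' e2
    exact absurd (e1'.trans e2) (not_le.2 hapl)
  rw [not_lt] at hapl
  have hapl0 : 0 ≤ aplus := ha.le.trans hapl
  set C : ℝ := (2 * ((d : ℝ) + 1) * (1 + ℓ₁) + 1 + aplus) * (((d : ℝ) + 1) * (D1 hprof + D2 hprof) + 1)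
    * (2 * (((d : ℝ) + 2) * c)) with hC_def
  have hC0 : 0 < C := by rw [hC_def]; positivity
  refine ⟨C, hC0, fun creg β hcreg hβ S K hK2 => ?_⟩
  obtain ⟨e₁, he₁, hth⟩ := cubeField_threshold d (c := c) (aplus := aplus) hℓ₁ hc.le ha hcreg hβ S K
  refine ⟨e₁, he₁, ?_⟩
  intro k hk hn hnK a m2 e1' e2 e3 e4 M hM hS hKM j hjlo hjhi Ac e he hle h17 Φ
  have hK1 : 1 ≤ K := le_trans (by norm_num) hK2
  obtain ⟨hak1, hak2⟩ := aSeq_window hℓ hk ha e1' e2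
  obtain ⟨hθ1, hsm2, hsm⟩ := hth e he hle _ hak1 hak2
  obtain ⟨hanti', hA', hder, hbd⟩ := cubeField_hyps (d := d) hn hS hK1 hnK hjlo hjhi hcreg he h17 (β := β)
  have hθ0 : 0 ≤ ((d : ℝ) + 1) * S * creg * e ^ β := by
    have := (Real.rpow_pos_of_pos he β).le; positivity
  have hθ'0 : 0 ≤ creg * e ^ β * (1 + D1 thetaProf * (((d : ℝ) + 1) * S) / K) := by
    have := (Real.rpow_pos_of_pos he β).le
    have := D1_nonneg contDiff_thetaProf hasCompactSupport_thetaProf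
    positivity
  have main := hL k hk hn a m2 e1' e2 e3 e4 M hM K j hK2 hKM (fun μ => e / ((ℓ + 1) ^ k : ℕ) * Ac 0 μ) _
    _ _ hanti' hθ0 hA' hθ'0 hder hbd hsm2 hsm Φ
  rw [kOp_smul, greenA_smul, smul_cubeField]
  refine main.trans (mul_le_mul_of_nonneg_right ?_ (supN_nonneg Φ))
  -- the constant: `(2(d+1)(1+ℓ₁θ) + 1 + a_k)·s/K·2(d+2)c ≤ C/K`
  have hKr : (0 : ℝ) < K := by exact_mod_cast hK1
  have h1 : 2 * ((d : ℝ) + 1) * (1 + ℓ₁ * (((d : ℝ) + 1) * S * creg * e ^ β)) + 1 + B1.aSeq a ((ℓ : ℝ) + 1) k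
      ≤ 2 * ((d : ℝ) + 1) * (1 + ℓ₁) + 1 + aplus := by
    have : ℓ₁ * (((d : ℝ) + 1) * S * creg * e ^ β) ≤ ℓ₁ * 1 := mul_le_mul_of_nonneg_left hθ1 hℓ₁
    nlinarith
  have h2 : ((d : ℝ) + 1) * (D1 hprof + D2 hprof) ≤ ((d : ℝ) + 1) * (D1 hprof + D2 hprof) + 1 := by linarith
  rw [hC_def, div_eq_mul_inv, div_eq_mul_inv]
  have hpos1 : 0 ≤ 2 * ((d : ℝ) + 1) * (1 + ℓ₁ * (((d : ℝ) + 1) * S * creg * e ^ β)) + 1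
      + B1.aSeq a ((ℓ : ℝ) + 1) k := by
    have : 0 ≤ B1.aSeq a ((ℓ : ℝ) + 1) k := by linarith
    positivity
  calc (2 * ((d : ℝ) + 1) * (1 + ℓ₁ * (((d : ℝ) + 1) * S * creg * e ^ β)) + 1 + B1.aSeq a ((ℓ : ℝ) + 1) k)
        * (((d : ℝ) + 1) * (D1 hprof + D2 hprof)) * (K : ℝ)⁻¹ * (2 * (((d : ℝ) + 2) * c))
      = ((2 * ((d : ℝ) + 1) * (1 + ℓ₁ * (((d : ℝ) + 1) * S * creg * e ^ β)) + 1 + B1.aSeq a ((ℓ : ℝ) + 1) k)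
        * (((d : ℝ) + 1) * (D1 hprof + D2 hprof)) * (2 * (((d : ℝ) + 2) * c))) * (K : ℝ)⁻¹ := by ring
    _ ≤ ((2 * ((d : ℝ) + 1) * (1 + ℓ₁) + 1 + aplus) * (((d : ℝ) + 1) * (D1 hprof + D2 hprof) + 1)
        * (2 * (((d : ℝ) + 2) * c))) * (K : ℝ)⁻¹ := by
        refine mul_le_mul_of_nonneg_right ?_ (inv_nonneg.2 hKr.le)
        exact mul_le_mul_of_nonneg_right (mul_le_mul h1 h2 hs (by positivity)) (by positivity)


/-- **(2.21) AT THE INTERIOR CUBES FOR A (1.7)-REGULAR FIELD — EVERY FACTOR «‖K_jG_k(□_j,Ã_j)h_j‖_{p₁/(i−1),p₁/i}»,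
«‖·‖_{2,2}» `≤ c₂O(1)M⁻¹` IN THE `η`-WEIGHTED NORMS, WITH ONLY «e SUFFICIENTLY SMALL»** (all pairs `1 ≤ p ≤ q < ∞`
with `1/p − 1/q ≤ 1/p₁`, `p₁ > d + 1`; same quantifier discipline as `eq220_cubeField`):
`‖K_{h_j}G_k(□,Ã_j)(h_jΦ)‖_{q,η} ≤ (C/K)‖Φ‖_{p,η}`.
[cite: Balaban1983RegularityDecay, (2.21) p. 578 «c₂O(1)M⁻¹» with §2 p. 575 (Ã_j) and (1.7) p. 573] -/
theorem eq221_cubeField (F : OrthFlow ι) {ℓ₁ : ℝ} (hℓ₁ : 0 ≤ ℓ₁)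
    (hLip : ∀ t (v : ι → ℝ), ((F.U t - 1) *ᵥ v) ⬝ᵥ ((F.U t - 1) *ᵥ v) ≤ (ℓ₁ * t) ^ 2 * (v ⬝ᵥ v))
    (d ℓ : ℕ) (hℓ : 1 ≤ ℓ) (amin aplus m2plus : ℝ) (ha : 0 < amin) {p₁ : ℝ} (hp₁ : (d : ℝ) + 1 < p₁) :
    ∃ C : ℝ, 0 < C ∧ ∀ (creg β : ℝ), 0 ≤ creg → 0 < β → ∀ (S K : ℕ), 2 ≤ K →
      ∃ e₁ : ℝ, 0 < e₁ ∧ ∀ (k : ℕ), 1 ≤ k → ∀ (hn : 1 ≤ (ℓ + 1) ^ k), 16 ≤ (ℓ + 1) ^ k * K →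
      ∀ (a m2 : ℝ), amin ≤ a → a ≤ aplus → 0 ≤ m2 → m2 ≤ m2plus →
      ∀ (M : Fin (d + 1) → ℕ), (∀ i, 1 ≤ M i) → (∀ i, M i ≤ S) → (∀ μ, K ∣ M μ) →
      ∀ (j : Fin (d + 1) → ℤ), (∀ μ, 1 ≤ j μ) → (∀ μ, (K : ℤ) * (j μ + 1) ≤ M μ) →
      ∀ (Ac : (Fin (d + 1) → ℤ) → Fin (d + 1) → ℝ) (e : ℝ), 0 < e → e ≤ e₁ →
        (∀ x ∈ Box d ℓ k M, ∀ μ ν : Fin (d + 1),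
          |Ac (x + e1 μ) ν - Ac x ν| ≤ creg * e ^ (β - 1) / ((ℓ + 1) ^ k : ℕ)) →
      ∀ (p q : ℝ), 1 ≤ p → p ≤ q → p⁻¹ - q⁻¹ ≤ p₁⁻¹ →
      ∀ Φ : ↥(Box d ℓ k M) × ι → ℝ,
        lpW d ℓ k q (kOp F (e / ((ℓ + 1) ^ k : ℕ)) ((ℓ + 1) ^ k) (B1.aSeq a ((ℓ : ℝ) + 1) k) m2 M (baseEmb hn M)
              (stairContour hn M) (cubeField (Box d ℓ k M) ((ℓ + 1) ^ k) K j (Ac 0) Ac) (hBox ((ℓ + 1) ^ k) K M j)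
            *ᵥ (greenA d F (e / ((ℓ + 1) ^ k : ℕ)) ℓ k a m2 M (baseEmb hn M) (stairContour hn M)
                (cubeField (Box d ℓ k M) ((ℓ + 1) ^ k) K j (Ac 0) Ac)
                *ᵥ (mulH (ι := ι) (hBox ((ℓ + 1) ^ k) K M j) *ᵥ Φ)))
          ≤ C / K * lpW d ℓ k p Φ := by
  obtain ⟨c, hc, C', hC', hL⟩ := eq221_hBox_weighted_stair F hℓ₁ hLip 1 d ℓ hℓ amin aplus m2plus ha hp₁
  have hs : 0 ≤ ((d : ℝ) + 1) * (D1 hprof + D2 hprof) := by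
    have := D1_nonneg contDiff_hprof hasCompactSupport_hprof
    have := D2_nonneg contDiff_hprof hasCompactSupport_hprof
    positivity
  by_cases hapl : aplus < amin
  · refine ⟨1, one_pos, fun creg β _ _ S K _ => ⟨1, one_pos, ?_⟩⟩
    intro k hk hn hnK a m2 e1' e2
    exact absurd (e1'.trans e2) (not_le.2 hapl)
  rw [not_lt] at hapl
  have hapl0 : 0 ≤ aplus := ha.le.trans hapl
  set C : ℝ := (2 * ((d : ℝ) + 1) * (1 + ℓ₁) + 1 + aplus) * (((d : ℝ) + 1) * (D1 hprof + D2 hprof) + 1)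
    * (2 * C') with hC_def
  have hC0 : 0 < C := by rw [hC_def]; positivity
  refine ⟨C, hC0, fun creg β hcreg hβ S K hK2 => ?_⟩
  obtain ⟨e₁, he₁, hth⟩ := cubeField_threshold d (c := c) (aplus := aplus) hℓ₁ hc.le ha hcreg hβ S K
  refine ⟨e₁, he₁, ?_⟩
  intro k hk hn hnK a m2 e1' e2 e3 e4 M hM hS hKM j hjlo hjhi Ac e he hle h17 p q hp hpq hσ Φ
  have hK1 : 1 ≤ K := le_trans (by norm_num) hK2
  obtain ⟨hak1, hak2⟩ := aSeq_window hℓ hk ha e1' e2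
  obtain ⟨hθ1, hsm2, hsm⟩ := hth e he hle _ hak1 hak2
  obtain ⟨hanti', hA', hder, hbd⟩ := cubeField_hyps (d := d) hn hS hK1 hnK hjlo hjhi hcreg he h17 (β := β)
  have hθ0 : 0 ≤ ((d : ℝ) + 1) * S * creg * e ^ β := by
    have := (Real.rpow_pos_of_pos he β).le; positivity
  have hθ'0 : 0 ≤ creg * e ^ β * (1 + D1 thetaProf * (((d : ℝ) + 1) * S) / K) := by
    have := (Real.rpow_pos_of_pos he β).le
    have := D1_nonneg contDiff_thetaProf hasCompactSupport_thetaProf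
    positivity
  have main := hL k hk hn a m2 e1' e2 e3 e4 M hM K j hK2 hKM (fun μ => e / ((ℓ + 1) ^ k : ℕ) * Ac 0 μ) _
    _ _ hanti' hθ0 hA' hθ'0 hder hbd hsm2 hsm p q hp hpq hσ Φ
  rw [kOp_smul, greenA_smul, smul_cubeField]
  refine main.trans (mul_le_mul_of_nonneg_right ?_ (lpW_nonneg d ℓ k p Φ))
  have hKr : (0 : ℝ) < K := by exact_mod_cast hK1
  have h1 : 2 * ((d : ℝ) + 1) * (1 + ℓ₁ * (((d : ℝ) + 1) * S * creg * e ^ β)) + 1 + B1.aSeq a ((ℓ : ℝ) + 1) k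
      ≤ 2 * ((d : ℝ) + 1) * (1 + ℓ₁) + 1 + aplus := by
    have : ℓ₁ * (((d : ℝ) + 1) * S * creg * e ^ β) ≤ ℓ₁ * 1 := mul_le_mul_of_nonneg_left hθ1 hℓ₁
    nlinarith
  have h2 : ((d : ℝ) + 1) * (D1 hprof + D2 hprof) ≤ ((d : ℝ) + 1) * (D1 hprof + D2 hprof) + 1 := by linarith
  rw [hC_def, div_eq_mul_inv, div_eq_mul_inv]
  have hpos1 : 0 ≤ 2 * ((d : ℝ) + 1) * (1 + ℓ₁ * (((d : ℝ) + 1) * S * creg * e ^ β)) + 1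
      + B1.aSeq a ((ℓ : ℝ) + 1) k := by
    have : 0 ≤ B1.aSeq a ((ℓ : ℝ) + 1) k := by linarith
    positivity
  calc (2 * ((d : ℝ) + 1) * (1 + ℓ₁ * (((d : ℝ) + 1) * S * creg * e ^ β)) + 1 + B1.aSeq a ((ℓ : ℝ) + 1) k)
        * (((d : ℝ) + 1) * (D1 hprof + D2 hprof)) * (K : ℝ)⁻¹ * (2 * C')
      = ((2 * ((d : ℝ) + 1) * (1 + ℓ₁ * (((d : ℝ) + 1) * S * creg * e ^ β)) + 1 + B1.aSeq a ((ℓ : ℝ) + 1) k)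
        * (((d : ℝ) + 1) * (D1 hprof + D2 hprof)) * (2 * C')) * (K : ℝ)⁻¹ := by ring
    _ ≤ ((2 * ((d : ℝ) + 1) * (1 + ℓ₁) + 1 + aplus) * (((d : ℝ) + 1) * (D1 hprof + D2 hprof) + 1)
        * (2 * C')) * (K : ℝ)⁻¹ := by
        refine mul_le_mul_of_nonneg_right ?_ (inv_nonneg.2 hKr.le)
        exact mul_le_mul_of_nonneg_right (mul_le_mul h1 h2 hs (by positivity)) (by positivity)

/-- **THE FIRST FACTOR «h_{ω₀}G_k(□_{ω₀},Ã_{ω₀})h_{ω₀}» OF (2.13) AND ITS COVARIANT DERIVATIVE AT THE INTERIOR CUBES FOR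
A (1.7)-REGULAR FIELD** (the constant `c₁` of (2.18)–(2.22) for the two members of (1.10)), with only «e sufficiently
small»: `‖h_jG_k(□,Ã_j)(h_jΦ)‖_∞ ≤ C‖Φ‖_∞` and `‖D^η_{Ã_j,μ}h_jG_k(□,Ã_j)(h_jΦ)‖_∞ ≤ C‖Φ‖_∞` for every `μ`.
[cite: Balaban1983RegularityDecay, (2.18)–(2.20) p. 578 «c₁» with §2 p. 575 (Ã_j) and (1.7) p. 573] -/
theorem eq218_cubeField (F : OrthFlow ι) {ℓ₁ : ℝ} (hℓ₁ : 0 ≤ ℓ₁)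
    (hLip : ∀ t (v : ι → ℝ), ((F.U t - 1) *ᵥ v) ⬝ᵥ ((F.U t - 1) *ᵥ v) ≤ (ℓ₁ * t) ^ 2 * (v ⬝ᵥ v))
    (d ℓ : ℕ) (hℓ : 1 ≤ ℓ) (amin aplus m2plus : ℝ) (ha : 0 < amin) :
    ∃ C : ℝ, 0 < C ∧ ∀ (creg β : ℝ), 0 ≤ creg → 0 < β → ∀ (S K : ℕ), 2 ≤ K →
      ∃ e₁ : ℝ, 0 < e₁ ∧ ∀ (k : ℕ), 1 ≤ k → ∀ (hn : 1 ≤ (ℓ + 1) ^ k), 16 ≤ (ℓ + 1) ^ k * K →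
      ∀ (a m2 : ℝ), amin ≤ a → a ≤ aplus → 0 ≤ m2 → m2 ≤ m2plus →
      ∀ (M : Fin (d + 1) → ℕ), (∀ i, 1 ≤ M i) → (∀ i, M i ≤ S) → (∀ μ, K ∣ M μ) →
      ∀ (j : Fin (d + 1) → ℤ), (∀ μ, 1 ≤ j μ) → (∀ μ, (K : ℤ) * (j μ + 1) ≤ M μ) →
      ∀ (Ac : (Fin (d + 1) → ℤ) → Fin (d + 1) → ℝ) (e : ℝ), 0 < e → e ≤ e₁ →
        (∀ x ∈ Box d ℓ k M, ∀ μ ν : Fin (d + 1),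
          |Ac (x + e1 μ) ν - Ac x ν| ≤ creg * e ^ (β - 1) / ((ℓ + 1) ^ k : ℕ)) →
      ∀ Φ : ↥(Box d ℓ k M) × ι → ℝ,
        supN (mulH (ι := ι) (hBox ((ℓ + 1) ^ k) K M j)
            *ᵥ (greenA d F (e / ((ℓ + 1) ^ k : ℕ)) ℓ k a m2 M (baseEmb hn M) (stairContour hn M)
                (cubeField (Box d ℓ k M) ((ℓ + 1) ^ k) K j (Ac 0) Ac)
                *ᵥ (mulH (ι := ι) (hBox ((ℓ + 1) ^ k) K M j) *ᵥ Φ)))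
          ≤ C * supN Φ ∧
        ∀ μ : Fin (d + 1),
          supN (derivA d F (e / ((ℓ + 1) ^ k : ℕ)) ℓ k M (cubeField (Box d ℓ k M) ((ℓ + 1) ^ k) K j (Ac 0) Ac) μ
              *ᵥ (mulH (ι := ι) (hBox ((ℓ + 1) ^ k) K M j)
                *ᵥ (greenA d F (e / ((ℓ + 1) ^ k : ℕ)) ℓ k a m2 M (baseEmb hn M) (stairContour hn M)
                    (cubeField (Box d ℓ k M) ((ℓ + 1) ^ k) K j (Ac 0) Ac)
                    *ᵥ (mulH (ι := ι) (hBox ((ℓ + 1) ^ k) K M j) *ᵥ Φ))))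
            ≤ C * supN Φ := by
  obtain ⟨c, hc, hL⟩ := eq218_first_hBox_sup_stair F hℓ₁ hLip 1 d ℓ hℓ amin aplus m2plus ha
  have hs : 0 ≤ ((d : ℝ) + 1) * (D1 hprof + D2 hprof) := by
    have := D1_nonneg contDiff_hprof hasCompactSupport_hprof
    have := D2_nonneg contDiff_hprof hasCompactSupport_hprof
    positivity
  set C : ℝ := (2 + ℓ₁ + ((d : ℝ) + 1) * (D1 hprof + D2 hprof)) * (2 * (((d : ℝ) + 2) * c)) with hC_def
  have hC0 : 0 < C := by rw [hC_def]; positivity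
  refine ⟨C, hC0, fun creg β hcreg hβ S K hK2 => ?_⟩
  obtain ⟨e₁, he₁, hth⟩ := cubeField_threshold d (c := c) (aplus := aplus) hℓ₁ hc.le ha hcreg hβ S K
  refine ⟨e₁, he₁, ?_⟩
  intro k hk hn hnK a m2 e1' e2 e3 e4 M hM hS hKM j hjlo hjhi Ac e he hle h17 Φ
  have hK1 : 1 ≤ K := le_trans (by norm_num) hK2
  obtain ⟨hak1, hak2⟩ := aSeq_window hℓ hk ha e1' e2
  obtain ⟨hθ1, hsm2, hsm⟩ := hth e he hle _ hak1 hak2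
  obtain ⟨-, hA', hder, hbd⟩ := cubeField_hyps (d := d) hn hS hK1 hnK hjlo hjhi hcreg he h17 (β := β)
  have hθ0 : 0 ≤ ((d : ℝ) + 1) * S * creg * e ^ β := by
    have := (Real.rpow_pos_of_pos he β).le; positivity
  have hθ'0 : 0 ≤ creg * e ^ β * (1 + D1 thetaProf * (((d : ℝ) + 1) * S) / K) := by
    have := (Real.rpow_pos_of_pos he β).le
    have := D1_nonneg contDiff_thetaProf hasCompactSupport_thetaProf
    positivity
  obtain ⟨main1, main2⟩ := hL k hk hn a m2 e1' e2 e3 e4 M hM K j hK2 hKM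
    (fun μ => e / ((ℓ + 1) ^ k : ℕ) * Ac 0 μ) _ _ _ hθ0 hA' hθ'0 hder hbd hsm2 hsm Φ
  have hKr : (1 : ℝ) ≤ K := by exact_mod_cast hK1
  have hc2 : 0 ≤ 2 * (((d : ℝ) + 2) * c) := by positivity
  have hC1 : 2 * (((d : ℝ) + 2) * c) ≤ C := by
    rw [hC_def]
    have : (1 : ℝ) ≤ 2 + ℓ₁ + ((d : ℝ) + 1) * (D1 hprof + D2 hprof) := by linarith
    nlinarith
  have hC2 : (1 + ℓ₁ * (((d : ℝ) + 1) * S * creg * e ^ β) + ((d : ℝ) + 1) * (D1 hprof + D2 hprof) / K)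
      * (2 * (((d : ℝ) + 2) * c)) ≤ C := by
    rw [hC_def]
    refine mul_le_mul_of_nonneg_right ?_ hc2
    have i1 : ℓ₁ * (((d : ℝ) + 1) * S * creg * e ^ β) ≤ ℓ₁ * 1 := mul_le_mul_of_nonneg_left hθ1 hℓ₁
    have i2 : ((d : ℝ) + 1) * (D1 hprof + D2 hprof) / K ≤ ((d : ℝ) + 1) * (D1 hprof + D2 hprof) :=
      div_le_self hs hKr
    linarith
  constructor
  · rw [greenA_smul, smul_cubeField]
    exact main1.trans (mul_le_mul_of_nonneg_right hC1 (supN_nonneg Φ))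
  · intro μ
    rw [derivA_smul, greenA_smul, smul_cubeField]
    exact (main2 μ).trans (mul_le_mul_of_nonneg_right hC2 (supN_nonneg Φ))


/-- **LEMMA 2.2 (2.17), SUP MEMBERS, AT THE CUBE CONFIGURATION OF A (1.7)-REGULAR FIELD — the per-cube input
`γ ≥ ‖G_k(□_j,Ã_j)‖` of the walk route WITH ONLY «e SUFFICIENTLY SMALL»**: there is `C > 0` (Lemma 2.2 at charge `1`)
such that for every `(c, β)`, `β > 0`, side bound `S` and cube size `K ≥ 1` there is `e₁ > 0` with: for every mesh
(`nK ≥ 16`), `a, m²` of the windows, box `□ = Π_μ[0, nM_μ)` (`M_μ ≤ S`), label `j` with its cube inside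
(`j_μ ≥ 1`, `K(j_μ + 1) ≤ M_μ`), every (1.7)-regular `A` on `□` and `0 < e ≤ e₁`:
`‖G_k(□,Ã_j)Φ‖_∞ ≤ C‖Φ‖_∞` and `‖D^η_{Ã_j,μ}G_k(□,Ã_j)Φ‖_∞ ≤ C‖Φ‖_∞` for every `μ` (coupling `e/n`, staircase
contours; the lineage's `B4Lemma22SupStair.lemma22_17_sup_stair` with its field hypotheses and smallness conditions
DISCHARGED by `cubeField_hyps` / `cubeField_threshold`).
[cite: Balaban1983RegularityDecay, Lemma 2.2 (2.17) p. 578 with §2 p. 575 (Ã_j) and (1.7) p. 573] -/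
theorem lemma22_sup_cubeField (F : OrthFlow ι) {ℓ₁ : ℝ} (hℓ₁ : 0 ≤ ℓ₁)
    (hLip : ∀ t (v : ι → ℝ), ((F.U t - 1) *ᵥ v) ⬝ᵥ ((F.U t - 1) *ᵥ v) ≤ (ℓ₁ * t) ^ 2 * (v ⬝ᵥ v))
    (d ℓ : ℕ) (hℓ : 1 ≤ ℓ) (amin aplus m2plus : ℝ) (ha : 0 < amin) :
    ∃ C : ℝ, 0 < C ∧ ∀ (creg β : ℝ), 0 ≤ creg → 0 < β → ∀ (S K : ℕ), 1 ≤ K →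
      ∃ e₁ : ℝ, 0 < e₁ ∧ ∀ (k : ℕ), 1 ≤ k → ∀ (hn : 1 ≤ (ℓ + 1) ^ k), 16 ≤ (ℓ + 1) ^ k * K →
      ∀ (a m2 : ℝ), amin ≤ a → a ≤ aplus → 0 ≤ m2 → m2 ≤ m2plus →
      ∀ (M : Fin (d + 1) → ℕ), (∀ i, 1 ≤ M i) → (∀ i, M i ≤ S) →
      ∀ (j : Fin (d + 1) → ℤ), (∀ μ, 1 ≤ j μ) → (∀ μ, (K : ℤ) * (j μ + 1) ≤ M μ) →
      ∀ (Ac : (Fin (d + 1) → ℤ) → Fin (d + 1) → ℝ) (e : ℝ), 0 < e → e ≤ e₁ →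
        (∀ x ∈ Box d ℓ k M, ∀ μ ν : Fin (d + 1),
          |Ac (x + e1 μ) ν - Ac x ν| ≤ creg * e ^ (β - 1) / ((ℓ + 1) ^ k : ℕ)) →
      ∀ Φ : ↥(Box d ℓ k M) × ι → ℝ,
        supN (greenA d F (e / ((ℓ + 1) ^ k : ℕ)) ℓ k a m2 M (baseEmb hn M) (stairContour hn M)
            (cubeField (Box d ℓ k M) ((ℓ + 1) ^ k) K j (Ac 0) Ac) *ᵥ Φ) ≤ C * supN Φ ∧
        ∀ μ : Fin (d + 1),
          supN (derivA d F (e / ((ℓ + 1) ^ k : ℕ)) ℓ k M (cubeField (Box d ℓ k M) ((ℓ + 1) ^ k) K j (Ac 0) Ac) μ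
              *ᵥ (greenA d F (e / ((ℓ + 1) ^ k : ℕ)) ℓ k a m2 M (baseEmb hn M) (stairContour hn M)
                  (cubeField (Box d ℓ k M) ((ℓ + 1) ^ k) K j (Ac 0) Ac) *ᵥ Φ))
            ≤ C * supN Φ := by
  obtain ⟨c, hc, hL⟩ := lemma22_17_sup_stair F hℓ₁ hLip 1 d ℓ hℓ amin aplus m2plus ha
  set C : ℝ := (2 + ℓ₁) * (2 * (((d : ℝ) + 2) * c)) with hC_def
  have hC0 : 0 < C := by rw [hC_def]; positivity
  refine ⟨C, hC0, fun creg β hcreg hβ S K hK1 => ?_⟩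
  obtain ⟨e₁, he₁, hth⟩ := cubeField_threshold d (c := c) (aplus := aplus) hℓ₁ hc.le ha hcreg hβ S K
  refine ⟨e₁, he₁, ?_⟩
  intro k hk hn hnK a m2 e1' e2 e3 e4 M hM hS j hjlo hjhi Ac e he hle h17 Φ
  obtain ⟨hak1, hak2⟩ := aSeq_window hℓ hk ha e1' e2
  obtain ⟨hθ1, hsm2, hsm⟩ := hth e he hle _ hak1 hak2
  obtain ⟨-, hA', hder, hbd⟩ := cubeField_hyps (d := d) hn hS hK1 hnK hjlo hjhi hcreg he h17 (β := β)
  have hθ0 : 0 ≤ ((d : ℝ) + 1) * S * creg * e ^ β := by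
    have := (Real.rpow_pos_of_pos he β).le; positivity
  have hθ'0 : 0 ≤ creg * e ^ β * (1 + D1 thetaProf * (((d : ℝ) + 1) * S) / K) := by
    have := (Real.rpow_pos_of_pos he β).le
    have := D1_nonneg contDiff_thetaProf hasCompactSupport_thetaProf
    positivity
  obtain ⟨main1, main2⟩ := hL k hk hn a m2 e1' e2 e3 e4 M hM (fun μ => e / ((ℓ + 1) ^ k : ℕ) * Ac 0 μ) _ _ _
    hθ0 hA' hθ'0 hder hbd hsm2 hsm Φ
  have hc2 : 0 ≤ 2 * (((d : ℝ) + 2) * c) := by positivity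
  have hC1 : 2 * (((d : ℝ) + 2) * c) ≤ C := by
    rw [hC_def]; nlinarith
  have hC2 : (1 + ℓ₁ * (((d : ℝ) + 1) * S * creg * e ^ β)) * (2 * (((d : ℝ) + 2) * c)) ≤ C := by
    rw [hC_def]
    refine mul_le_mul_of_nonneg_right ?_ hc2
    have : ℓ₁ * (((d : ℝ) + 1) * S * creg * e ^ β) ≤ ℓ₁ * 1 := mul_le_mul_of_nonneg_left hθ1 hℓ₁
    linarith
  constructor
  · rw [greenA_smul, smul_cubeField]
    have hsum : 0 ≤ ∑ μ, supN (B4Lemma22ReduceZero.derivA0 d F 1 ℓ k M (fun μ => e / ((ℓ + 1) ^ k : ℕ) * Ac 0 μ) μ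
        *ᵥ (greenA d F 1 ℓ k a m2 M (baseEmb hn M) (stairContour hn M)
            (constBond (fun μ => e / ((ℓ + 1) ^ k : ℕ) * Ac 0 μ) Subtype.val
              + fun u v => e / ((ℓ + 1) ^ k : ℕ) * cubeFluct (Box d ℓ k M) ((ℓ + 1) ^ k) K j (Ac 0) Ac u v) *ᵥ Φ)) :=
      Finset.sum_nonneg fun μ _ => supN_nonneg _
    have h1 := (le_add_of_nonneg_right hsum).trans main1
    exact h1.trans (mul_le_mul_of_nonneg_right hC1 (supN_nonneg Φ))
  · intro μ
    rw [derivA_smul, greenA_smul, smul_cubeField]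
    exact (main2 μ).trans (mul_le_mul_of_nonneg_right hC2 (supN_nonneg Φ))

/-- **(2.20) ON THE PRINT'S CUBE `□_j` ITSELF** (side `2M` — here `M_μ = 2K` unit blocks —, label at the centre
`j_μ = 1`): for every (1.7)-regular `A` on `□_j` and `0 < e ≤ e₁(c, β, K)`, `‖K_{h_j}G_k(□_j,Ã_j)(h_jΦ)‖_∞ ≤
(C/K)‖Φ‖_∞` — the hypotheses of `eq220_cubeField` on box, label and size are met by the cube «of the size 2M and with
center in Mj». [cite: Balaban1983RegularityDecay, (2.20) p. 578 with §2 p. 575 «□_j is a cube of the size 2M»] -/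
theorem eq220_cubeField_std (F : OrthFlow ι) {ℓ₁ : ℝ} (hℓ₁ : 0 ≤ ℓ₁)
    (hLip : ∀ t (v : ι → ℝ), ((F.U t - 1) *ᵥ v) ⬝ᵥ ((F.U t - 1) *ᵥ v) ≤ (ℓ₁ * t) ^ 2 * (v ⬝ᵥ v))
    (d ℓ : ℕ) (hℓ : 1 ≤ ℓ) (amin aplus m2plus : ℝ) (ha : 0 < amin) :
    ∃ C : ℝ, 0 < C ∧ ∀ (creg β : ℝ), 0 ≤ creg → 0 < β → ∀ (K : ℕ), 2 ≤ K →
      ∃ e₁ : ℝ, 0 < e₁ ∧ ∀ (k : ℕ), 1 ≤ k → ∀ (hn : 1 ≤ (ℓ + 1) ^ k), 16 ≤ (ℓ + 1) ^ k * K →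
      ∀ (a m2 : ℝ), amin ≤ a → a ≤ aplus → 0 ≤ m2 → m2 ≤ m2plus →
      ∀ (Ac : (Fin (d + 1) → ℤ) → Fin (d + 1) → ℝ) (e : ℝ), 0 < e → e ≤ e₁ →
        (∀ x ∈ Box d ℓ k (fun _ => 2 * K), ∀ μ ν : Fin (d + 1),
          |Ac (x + e1 μ) ν - Ac x ν| ≤ creg * e ^ (β - 1) / ((ℓ + 1) ^ k : ℕ)) →
      ∀ Φ : ↥(Box d ℓ k (fun _ => 2 * K)) × ι → ℝ,
        supN (kOp F (e / ((ℓ + 1) ^ k : ℕ)) ((ℓ + 1) ^ k) (B1.aSeq a ((ℓ : ℝ) + 1) k) m2 (fun _ => 2 * K)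
              (baseEmb hn _) (stairContour hn _)
              (cubeField (Box d ℓ k (fun _ => 2 * K)) ((ℓ + 1) ^ k) K (fun _ => 1) (Ac 0) Ac)
              (hBox ((ℓ + 1) ^ k) K (fun _ => 2 * K) (fun _ => 1))
            *ᵥ (greenA d F (e / ((ℓ + 1) ^ k : ℕ)) ℓ k a m2 (fun _ => 2 * K) (baseEmb hn _) (stairContour hn _)
                (cubeField (Box d ℓ k (fun _ => 2 * K)) ((ℓ + 1) ^ k) K (fun _ => 1) (Ac 0) Ac)
                *ᵥ (mulH (ι := ι) (hBox ((ℓ + 1) ^ k) K (fun _ => 2 * K) (fun _ => 1)) *ᵥ Φ)))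
          ≤ C / K * supN Φ := by
  obtain ⟨C, hC, h⟩ := eq220_cubeField F hℓ₁ hLip d ℓ hℓ amin aplus m2plus ha
  refine ⟨C, hC, fun creg β hcreg hβ K hK2 => ?_⟩
  obtain ⟨e₁, he₁, h'⟩ := h creg β hcreg hβ (2 * K) K hK2
  refine ⟨e₁, he₁, ?_⟩
  intro k hk hn hnK a m2 e1' e2 e3 e4 Ac e he hle h17 Φ
  have hK1 : 1 ≤ K := le_trans (by norm_num) hK2
  exact h' k hk hn hnK a m2 e1' e2 e3 e4 (fun _ => 2 * K) (fun _ => by omega) (fun _ => le_rfl)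
    (fun _ => Dvd.intro_left 2 rfl) (fun _ => 1) (fun _ => le_rfl) (fun _ => by push_cast; omega) Ac e he hle h17 Φ

/-! ### v1.1 (append-only): (2.17) in the printed `η`-weighted `L^p → L^q` norms at `Ã_j` -/

/-- **LEMMA 2.2 (2.17), `η`-WEIGHTED `L^p → L^q` MEMBERS `G_k(□,Ã_j)`, `D^η_{Ã_j,μ}G_k(□,Ã_j)`, AT THE CUBE
CONFIGURATION OF A (1.7)-REGULAR FIELD, WITH ONLY «e SUFFICIENTLY SMALL»** (all pairs `1 ≤ p ≤ q < ∞` with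
`1/p − 1/q ≤ 1/p₁`, `p₁ > d + 1`; the constant independent of `η`): there is `C > 0` (Lemma 2.2 at charge `1`) such
that for every `(c, β)`, side bound `S` and cube size `K ≥ 1` there is `e₁ > 0` with, for every instance as in
`lemma22_sup_cubeField` and every such pair `(p, q)`: `‖G_k(□,Ã_j)Φ‖_{q,η} ≤ C‖Φ‖_{p,η}` and
`‖D^η_{Ã_j,μ}G_k(□,Ã_j)Φ‖_{q,η} ≤ C‖Φ‖_{p,η}` for every `μ` (the lineage's `B4Lemma22EtaBox.lemma22_17_weighted_stair`
with its field hypotheses and smallness conditions DISCHARGED).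
[cite: Balaban1983RegularityDecay, Lemma 2.2 (2.17) p. 578 with §2 p. 575 (Ã_j) and (1.7) p. 573] -/
theorem lemma22_weighted_cubeField (F : OrthFlow ι) {ℓ₁ : ℝ} (hℓ₁ : 0 ≤ ℓ₁)
    (hLip : ∀ t (v : ι → ℝ), ((F.U t - 1) *ᵥ v) ⬝ᵥ ((F.U t - 1) *ᵥ v) ≤ (ℓ₁ * t) ^ 2 * (v ⬝ᵥ v))
    (d ℓ : ℕ) (hℓ : 1 ≤ ℓ) (amin aplus m2plus : ℝ) (ha : 0 < amin) {p₁ : ℝ} (hp₁ : (d : ℝ) + 1 < p₁) :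
    ∃ C : ℝ, 0 < C ∧ ∀ (creg β : ℝ), 0 ≤ creg → 0 < β → ∀ (S K : ℕ), 1 ≤ K →
      ∃ e₁ : ℝ, 0 < e₁ ∧ ∀ (k : ℕ), 1 ≤ k → ∀ (hn : 1 ≤ (ℓ + 1) ^ k), 16 ≤ (ℓ + 1) ^ k * K →
      ∀ (a m2 : ℝ), amin ≤ a → a ≤ aplus → 0 ≤ m2 → m2 ≤ m2plus →
      ∀ (M : Fin (d + 1) → ℕ), (∀ i, 1 ≤ M i) → (∀ i, M i ≤ S) →
      ∀ (j : Fin (d + 1) → ℤ), (∀ μ, 1 ≤ j μ) → (∀ μ, (K : ℤ) * (j μ + 1) ≤ M μ) →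
      ∀ (Ac : (Fin (d + 1) → ℤ) → Fin (d + 1) → ℝ) (e : ℝ), 0 < e → e ≤ e₁ →
        (∀ x ∈ Box d ℓ k M, ∀ μ ν : Fin (d + 1),
          |Ac (x + e1 μ) ν - Ac x ν| ≤ creg * e ^ (β - 1) / ((ℓ + 1) ^ k : ℕ)) →
      ∀ (p q : ℝ), 1 ≤ p → p ≤ q → p⁻¹ - q⁻¹ ≤ p₁⁻¹ →
      ∀ Φ : ↥(Box d ℓ k M) × ι → ℝ,
        lpW d ℓ k q (greenA d F (e / ((ℓ + 1) ^ k : ℕ)) ℓ k a m2 M (baseEmb hn M) (stairContour hn M)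
            (cubeField (Box d ℓ k M) ((ℓ + 1) ^ k) K j (Ac 0) Ac) *ᵥ Φ) ≤ C * lpW d ℓ k p Φ ∧
        ∀ μ : Fin (d + 1),
          lpW d ℓ k q (derivA d F (e / ((ℓ + 1) ^ k : ℕ)) ℓ k M (cubeField (Box d ℓ k M) ((ℓ + 1) ^ k) K j (Ac 0) Ac) μ
              *ᵥ (greenA d F (e / ((ℓ + 1) ^ k : ℕ)) ℓ k a m2 M (baseEmb hn M) (stairContour hn M)
                  (cubeField (Box d ℓ k M) ((ℓ + 1) ^ k) K j (Ac 0) Ac) *ᵥ Φ))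
            ≤ C * lpW d ℓ k p Φ := by
  obtain ⟨c, hc, C', hC', hL⟩ := lemma22_17_weighted_stair F hℓ₁ hLip 1 d ℓ hℓ amin aplus m2plus ha hp₁
  set C : ℝ := (2 + ℓ₁) * (2 * C') with hC_def
  have hC0 : 0 < C := by rw [hC_def]; positivity
  refine ⟨C, hC0, fun creg β hcreg hβ S K hK1 => ?_⟩
  obtain ⟨e₁, he₁, hth⟩ := cubeField_threshold d (c := c) (aplus := aplus) hℓ₁ hc.le ha hcreg hβ S K
  refine ⟨e₁, he₁, ?_⟩
  intro k hk hn hnK a m2 e1' e2 e3 e4 M hM hS j hjlo hjhi Ac e he hle h17 p q hp hpq hσ Φ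
  obtain ⟨hak1, hak2⟩ := aSeq_window hℓ hk ha e1' e2
  obtain ⟨hθ1, hsm2, hsm⟩ := hth e he hle _ hak1 hak2
  obtain ⟨-, hA', hder, hbd⟩ := cubeField_hyps (d := d) hn hS hK1 hnK hjlo hjhi hcreg he h17 (β := β)
  have hθ0 : 0 ≤ ((d : ℝ) + 1) * S * creg * e ^ β := by
    have := (Real.rpow_pos_of_pos he β).le; positivity
  have hθ'0 : 0 ≤ creg * e ^ β * (1 + D1 thetaProf * (((d : ℝ) + 1) * S) / K) := by
    have := (Real.rpow_pos_of_pos he β).le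
    have := D1_nonneg contDiff_thetaProf hasCompactSupport_thetaProf
    positivity
  obtain ⟨main0, -, main2⟩ := hL k hk hn a m2 e1' e2 e3 e4 M hM (fun μ => e / ((ℓ + 1) ^ k : ℕ) * Ac 0 μ) _ _ _
    hθ0 hA' hθ'0 hder hbd hsm2 hsm p q hp hpq hσ Φ
  have hc2 : 0 ≤ 2 * C' := by positivity
  have hC1 : 2 * C' ≤ C := by rw [hC_def]; nlinarith
  have hC2 : (1 + ℓ₁ * (((d : ℝ) + 1) * S * creg * e ^ β)) * (2 * C') ≤ C := by
    rw [hC_def]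
    refine mul_le_mul_of_nonneg_right ?_ hc2
    have : ℓ₁ * (((d : ℝ) + 1) * S * creg * e ^ β) ≤ ℓ₁ * 1 := mul_le_mul_of_nonneg_left hθ1 hℓ₁
    linarith
  constructor
  · rw [greenA_smul, smul_cubeField]
    exact main0.trans (mul_le_mul_of_nonneg_right hC1 (lpW_nonneg d ℓ k p Φ))
  · intro μ
    rw [derivA_smul, greenA_smul, smul_cubeField]
    exact (main2 μ).trans (mul_le_mul_of_nonneg_right hC2 (lpW_nonneg d ℓ k p Φ))

end Payoff

end

end Literature.MathematicalPhysics.QuantumFieldTheory.Balaban1983to89.B4Eq220CubeField
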